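import Mathlib
import Literature.Geometry.DiscreteGeometry.DelaunaySubdivision
import Literature.Geometry.DiscreteGeometry.SolidAngleFraction
import Summits.AtomisticToContinuum.Crystallization.Theorems.SquareWellLayerCakeAveragedTwelveEdgeFlat
import HarnessLib

/-!
# Stub `stub_tetGauge` of line `Sketch` (idea par-five-delaunay-recount) of crux
`SquareWellLayerCake.AveragedTwelve` (stmt-AtomisticToContinuum-15806)

THE TETRAHEDRON GAUGE of the line's recounted excess: pure finite bookkeeping, no metric content.
`K` triangulates the finite site set `ω ⊂ ℝ³`, `P ⊆ ω` lies in the interior of `conv ω`, `Nb p`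
is the set of `K`-neighbours of `p ∈ P`, `S p z` the set of cells (simplices with `4` vertices) of
`K` on the edge `pz`, and `Cells` the set of all cells of `K`.  For `p ∈ P`, `z ∈ Nb p` write
`t_pz := #(S p z)`, `w_pz := 6` if `ρ < |pz|` ("far") and `5` otherwise ("near"), and
`df(t,p,z)` for the unit-ball volume fraction at `p` of the dihedral wedge of the cell `t` along
its edge `pz`.  Claim:
`Σ_{p ∈ P} Σ_{z ∈ Nb p} (t_pz − 5 − [far])
   = Σ_{t ∈ Cells} Σ_{p ∈ P ∩ t} (3 − Σ_{z ∈ t∖p} w_pz df(t,p,z))`.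

PROOF.  By the landed dihedral partition of unity `ParFiveRecountEdgeFlat.stub_edgeFlat`,
`Σ_{t ∈ S p z} df(t,p,z) = 1` for `p ∈ P`, `z ∈ Nb p`; hence
`t_pz − 5 − [far] = t_pz − w_pz = Σ_{t ∈ S p z} (1 − w_pz df(t,p,z))`.  Swapping the double sum
over pairs `(z, t)` (`z ∈ Nb p`, `t ∈ S p z` iff `t ∈ Cells`, `p ∈ t`, `z ∈ t ∖ p`; the edge
`{p, z} ⊆ t` is a face by down-closure) and using `#(t ∖ p) = 3` gives the per-site identity
`Σ_{z ∈ Nb p} (t_pz − w_pz) = Σ_{t ∈ Cells, p ∈ t} (3 − Σ_{z ∈ t∖p} w_pz df(t,p,z))`; a second swap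
of the sum over `p ∈ P` and `t ∈ Cells` finishes.  The abstract bookkeeping is `regauge_comb`.
-/

noncomputable section

open scoped BigOperators Classical

namespace Summit.AtomisticToContinuum.Crystallization.Theorems.ParFiveRecountTetGauge

open Literature.Geometry.DiscreteGeometry

/-- **Tetrahedron regauging (abstract form).**  If the pairs `(z, t)` with `z ∈ Nb p`, `t ∈ S p z`
are exactly the pairs with `t ∈ Cells`, `p ∈ t`, `z ∈ t ∖ p`, every cell has `4` vertices, and the
weights `df t p z` of the cells on each edge `pz` sum to `1`, then
`Σ_p Σ_{z ∈ Nb p} (#(S p z) − w p z)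
   = Σ_{t ∈ Cells} Σ_{p ∈ P ∩ t} (3 − Σ_{z ∈ t∖p} w p z · df t p z)`.
[folklore] -/
theorem regauge_comb {α : Type*} [DecidableEq α] (P : Finset α) (Nb : α → Finset α)
    (S : α → α → Finset (Finset α)) (Cells : Finset (Finset α)) (w : α → α → ℝ)
    (df : Finset α → α → α → ℝ)
    (hmem : ∀ p ∈ P, ∀ z t, z ∈ Nb p ∧ t ∈ S p z ↔
      z ∈ t.erase p ∧ t ∈ Cells.filter (fun t => p ∈ t))
    (hcard : ∀ t ∈ Cells, t.card = 4)
    (hE : ∀ p ∈ P, ∀ z ∈ Nb p, ∑ t ∈ S p z, df t p z = 1) :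
    ∑ p ∈ P, ∑ z ∈ Nb p, (((S p z).card : ℝ) - w p z) =
      ∑ t ∈ Cells, ∑ p ∈ P.filter (fun p => p ∈ t),
        (3 - ∑ z ∈ t.erase p, w p z * df t p z) := by
  -- (1) the per-site identity
  have hper : ∀ p ∈ P, ∑ z ∈ Nb p, (((S p z).card : ℝ) - w p z) =
      ∑ t ∈ Cells.filter (fun t => p ∈ t), (3 - ∑ z ∈ t.erase p, w p z * df t p z) := by
    intro p hp
    have h1 : ∀ z ∈ Nb p, (((S p z).card : ℝ) - w p z) = ∑ t ∈ S p z, (1 - w p z * df t p z) := by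
      intro z hz
      rw [Finset.sum_sub_distrib, ← Finset.mul_sum, hE p hp z hz, Finset.sum_const, nsmul_eq_mul,
        mul_one, mul_one]
    rw [Finset.sum_congr rfl h1,
      Finset.sum_comm' (t' := Cells.filter (fun t => p ∈ t)) (s' := fun t => t.erase p) (hmem p hp)]
    refine Finset.sum_congr rfl fun t ht => ?_
    rw [Finset.mem_filter] at ht
    rw [Finset.sum_sub_distrib, Finset.sum_const, Finset.card_erase_of_mem ht.2, hcard t ht.1]
    norm_num
  -- (2) swap the sums over sites and cells
  rw [Finset.sum_congr rfl hper,
    Finset.sum_comm' (t' := Cells) (s' := fun t => P.filter (fun p => p ∈ t))]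
  intro p t
  simp only [Finset.mem_filter]
  tauto

/-- **The registered stub `stub_tetGauge` of line `Sketch`** (tetrahedron gauge of the recounted
excess): with `t_pz = #(S p z)`, `w_pz = 6` (far) / `5` (near) and `df(t,p,z)` the dihedral
fraction of the cell `t` at its edge `pz`,
`Σ_{p ∈ P} Σ_{z ∈ Nb p} (t_pz − 5 − [far])
   = Σ_{t ∈ Cells} Σ_{p ∈ P ∩ t} (3 − Σ_{z ∈ t∖p} w_pz df(t,p,z))`,
by the dihedral partition of unity `stub_edgeFlat` and two exchanges of finite sums
(`regauge_comb`). -/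
theorem stub_tetGauge : ∀ (ρ : ℝ) (ω P : Finset (EuclideanSpace ℝ (Fin 3))), P ⊆ ω → (↑P : Set (EuclideanSpace ℝ (Fin 3))) ⊆ interior (convexHull ℝ (↑ω : Set (EuclideanSpace ℝ (Fin 3)))) → ∀ (K : Geometry.SimplicialComplex ℝ (EuclideanSpace ℝ (Fin 3))), Literature.Geometry.DiscreteGeometry.IsTriangulation (↑ω : Set (EuclideanSpace ℝ (Fin 3))) K → ∀ (Nb : EuclideanSpace ℝ (Fin 3) → Finset (EuclideanSpace ℝ (Fin 3))), (∀ p ∈ P, ∀ z, z ∈ Nb p ↔ z ≠ p ∧ ({p, z} : Finset (EuclideanSpace ℝ (Fin 3))) ∈ K.faces) → ∀ (S : EuclideanSpace ℝ (Fin 3) → EuclideanSpace ℝ (Fin 3) → Finset (Finset (EuclideanSpace ℝ (Fin 3)))), (∀ p ∈ P, ∀ z ∈ Nb p, ∀ t, t ∈ S p z ↔ t ∈ K.faces ∧ p ∈ t ∧ z ∈ t ∧ t.card = 4) → ∀ (Cells : Finset (Finset (EuclideanSpace ℝ (Fin 3)))), (∀ t, t ∈ Cells ↔ t ∈ K.faces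 ∧ t.card = 4) → ((∑ p ∈ P, ∑ z ∈ Nb p, (((S p z).card : ℤ) - 5 - if ρ < dist p z then 1 else 0) : ℤ) : ℝ) = ∑ t ∈ Cells, ∑ p ∈ P.filter (fun p => p ∈ t), (3 - ∑ z ∈ (t).erase p, (if ρ < dist p z then (6 : ℝ) else 5) * Literature.Geometry.DiscreteGeometry.ballFraction p (Literature.Geometry.DiscreteGeometry.apexWedge p (z - p) (fun w : ↥(((t).erase p).erase z) => (↑w : EuclideanSpace ℝ (Fin 3)) - p))) := by
  intro ρ ω P hPω hPint K hK Nb hNb S hS Cells hCells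
  -- the `ℤ → ℝ` cast of the left-hand side, with `5 + [far] = w`
  have hcast : ((∑ p ∈ P, ∑ z ∈ Nb p,
      (((S p z).card : ℤ) - 5 - if ρ < dist p z then 1 else 0) : ℤ) : ℝ) =
      ∑ p ∈ P, ∑ z ∈ Nb p, (((S p z).card : ℝ) - (if ρ < dist p z then (6 : ℝ) else 5)) := by
    push_cast
    refine Finset.sum_congr rfl fun p _ => Finset.sum_congr rfl fun z _ => ?_
    split_ifs <;> ring
  rw [hcast]
  refine regauge_comb P Nb S Cells (fun p z => if ρ < dist p z then (6 : ℝ) else 5)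
    (fun t p z => ballFraction p (apexWedge p (z - p)
      (fun w : ↥((t.erase p).erase z) => (↑w : EuclideanSpace ℝ (Fin 3)) - p))) ?_ ?_ ?_
  · -- the pairs `(z, t)`: `z ∈ Nb p`, `t ∈ S p z` iff `t ∈ Cells`, `p ∈ t`, `z ∈ t ∖ p`
    intro p hp z t
    constructor
    · rintro ⟨hz, ht⟩
      have hz' := (hNb p hp z).1 hz
      have ht' := (hS p hp z hz t).1 ht
      exact ⟨Finset.mem_erase.2 ⟨hz'.1, ht'.2.2.1⟩,
        Finset.mem_filter.2 ⟨(hCells t).2 ⟨ht'.1, ht'.2.2.2⟩, ht'.2.1⟩⟩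
    · rintro ⟨hz, ht⟩
      rw [Finset.mem_filter] at ht
      have ht' := (hCells t).1 ht.1
      have hzp : z ≠ p := Finset.ne_of_mem_erase hz
      have hzt : z ∈ t := Finset.mem_of_mem_erase hz
      have hzNb : z ∈ Nb p := by
        rw [hNb p hp]
        refine ⟨hzp, K.down_closed ht'.1 ?_ (Finset.insert_nonempty _ _)⟩
        intro x hx
        rcases Finset.mem_insert.1 hx with rfl | hx
        · exact ht.2
        · rw [Finset.mem_singleton.1 hx]; exact hzt
      exact ⟨hzNb, (hS p hp z hzNb t).2 ⟨ht'.1, ht.2, hzt, ht'.2⟩⟩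
  · -- every cell has four vertices
    exact fun t ht => ((hCells t).1 ht).2
  · -- the dihedral partition of unity around each edge `pz`
    intro p hp z hz
    have hz' := (hNb p hp z).1 hz
    exact ParFiveRecountEdgeFlat.stub_edgeFlat ω K hK p (hPω hp) (hPint (Finset.mem_coe.2 hp)) z
      hz'.1 hz'.2 (S p z) (hS p hp z hz)

end Summit.AtomisticToContinuum.Crystallization.Theorems.ParFiveRecountTetGauge

end
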